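import Summits.Ventures.GridStability.Bench.KUNDUR2ACSGDeg2AOwnVNu4ibk3m1Pp
import Summits.Ventures.GridStability.Lyapunov.CertificateSoundness
import Summits.Ventures.GridStability.Lyapunov.PolyRecast
import Mathlib.Analysis.Calculus.Deriv.Pi
import Mathlib.Analysis.Normed.Module.FiniteDimension
import HarnessLib

/-!
# G2.a «K2A-alg-deg2»-roa (recast half) — from the kernel-checked own-V certificate
# `Bench/KUNDUR2ACSGDeg2AOwnVNu4ibk3m1Pp` (deg 2, toolchain A, level 3/53) to invariance, no pole
# slip and attraction of the certified sublevel piece FOR THE RECAST MODEL M′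

Venture GRIDFUSION, `plan/PARTITION.md` A2 (alg / roa), A5 (bridge), A6 (arc rule), A24 third
addendum (1) + lead RULING R-G2A-OBJECT 2026-08-27T05:34:39Z (S2 candidate #22 «G2.a-K2A-alg-deg2»
re-pointed to sos-1's OWN-V object; «-roa later (lyap-1)», lead g3 FINAL HANDOFF 06:25:58Z); seat
gridfusion-lyap-1 (g4). Companion of sos-5's `Bench/KUNDUR2ACSGDeg2AOwnVNu4ibk3m1Pp{Data1,Data2,Psd1,}.lean`
(p504007 / p504876 / p505189 / main p505431; A file of record
`cert/A/KUNDUR2A-CSG-deg2-A-ownV-nu4ibk3m1-pp.json` sha16 `108ef3688ed559ee`, sos-1 j269461 /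
j269536, own-V object `4c09d2ae0c60f8bf`; B twin sos-2 `e79ef9596faf3a63`, ref-1 rows 157 / 160),
whose decls it uses VERBATIM (`deg2_A_ownV_nu4ibk3m1_pp_{f_<var>, h1, h2, h3, V, Vdot}` — `Poly.eval`
of the `_poly` literals, unfolded through their `_eq` lemmas — and the six CERTIFIED identities
`deg2_A_ownV_nu4ibk3m1_pp_{V_pos, Vdot_neg, level_in_ball, arc_excl_kappa_2, arc_excl_kappa_11,
arc_excl_kappa_12}`); the analysis is `Lyapunov/{SublevelTrapping, CertificateSoundness,
PolyRecast}.lean` (p459619 / p460300 / p482110: the chain rule is the GENERIC route — `V̇_poly =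
lieDeriv f V_poly` and `lieDeriv f h_j = 0` by one `decide` each; generator lyap-1 `gen6.py`). This
file is the RECAST HALF; the return to machine angles and speeds of model-1's two-area model
(`Kundur2A.csgPre.toModelRel (1/10) a′`, chain rule `Kundur2A.hasDerivWithinAt_embedRel`, literal
field `RecastLiteralsKundur2A.csgPre_relField_lambda_eq`) is the sibling
`KUNDUR2ACSGDeg2AOwnVNu4ibk3m1PpRoaModel.lean`.

THREE COLUMNS. CERTIFIED (kernel, in the Bench file): on `{h = 0}`: `V ≥ (1/36) φ_w`; on
`{h = 0} ∩ {V ≤ 3/53} ∩ {φ_w ≤ 1}`: `V̇ ≤ −(1/2000) φ_w`; on `{h = 0} ∩ {V ≤ 3/53}`: `φ_w ≤ 1` and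
`κ₂, κ₁₁, κ₁₂ ≤ 1`, with `φ_w = Σ(σ² + κ²) + Σν²/4` and the quadratic own-V `V` of the file.
MODELLED: every theorem of THIS file is about the recast polynomial system `ż = F(z)` on
`{h₁ = h₂ = h₃ = 0} ⊂ ℝ⁹` — the TREE OBJECT `Kundur2A.csgPre.relField (1/10)` (model-1 p466090 /
p473726, literal p482037) = the relative-speed recast, w.r.t. the machine at bus 1, of the
Chow–Sanchez-Gasca two-area four-machine classical model with constant-impedance loads (transfer
conductances kept), K rounded h12, scaled time with unit inertias, and the ASSUMED UNIFORM DAMPING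
RATIO `λ = 1/10` (printed `D = 0`) — census label «synthetic uniform damping on the printed two-area
network», never a sentence about the printed `D = 0` system; variables
`z = (σ₂, κ₂, σ₁₁, κ₁₁, σ₁₂, κ₁₂, ν₂, ν₁₁, ν₁₂)`, `σ = sin u`, `κ = 1 − cos u`, `u` = relative
rotor-angle deviation from the equilibrium, `ν` = relative speed; MODEL-VALIDITY token = model-2's
KUNDUR2A-CSG block + MV-λ(1/10) (MV-2(pre-fault, lossy reduced) + MV-P + MV-h12 + MV-E). VALIDATED:
nothing (the synthesis SDP and its margins are provenance of the Bench row, never the claim). No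
sentence of this file says a machine or a grid is stable; «region of attraction» below means: the
stated set of initial conditions OF THE MODEL M′ is carried to the model's equilibrium.

STATEMENT (`deg2_A_ownV_nu4ibk3m1_pp_roa`): for every `0 < γ ≤ 3/53` and every solution `z` of the
recast system on `[0, ∞)` (Mathlib sense: continuous, right derivative `F (z t)`) with
`z 0 ∈ M = {h₁ = h₂ = h₃ = 0}` and `V(z 0) ≤ γ`: `V(z t) ≤ γ` and `κ₂(t), κ₁₁(t), κ₁₂(t) ≤ 1` for all
`t ≥ 0`, and `z t → 0`. Obligations: dissipation in bridge form (`LVz_le`), `W = (1/2000) φ_w`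
positive definite (`eq_zero_of_Wz`, `Wz_pos`), compactness of the certified piece from
`level_in_ball` (`‖z‖∞ ≤ 2`), the chain rule and the three first integrals via `PolyRecast`, then
`Lyapunov.certificate_invariance_tendsto_univ`.
-/

namespace Summit.Ventures.GridStability.Bench.KUNDUR2ACSG

open Set Filter Metric Topology Real
open Summit.Ventures.GridStability.Lyapunov
open Literature.Computation.Certificates Literature.Computation.Certificates.SOS

noncomputable section

/-! ### Recast phase space `Fin 9 → ℝ`, coordinates in the certificate's variable order ['sigma_2', 'kappa_2', 'sigma_11', 'kappa_11', 'sigma_12', 'kappa_12', 'nu_2', 'nu_11', 'nu_12'] -/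

/-- The recast field of the instance on `Fin 9 → ℝ` (components = the Bench decls verbatim).
MODELLED column. [folklore] -/
def deg2_A_ownV_nu4ibk3m1_pp_F (z : Fin 9 → ℝ) : Fin 9 → ℝ :=
  ![deg2_A_ownV_nu4ibk3m1_pp_f_sigma_2 (z 0) (z 1) (z 2) (z 3) (z 4) (z 5) (z 6) (z 7) (z 8),
    deg2_A_ownV_nu4ibk3m1_pp_f_kappa_2 (z 0) (z 1) (z 2) (z 3) (z 4) (z 5) (z 6) (z 7) (z 8),
    deg2_A_ownV_nu4ibk3m1_pp_f_sigma_11 (z 0) (z 1) (z 2) (z 3) (z 4) (z 5) (z 6) (z 7) (z 8),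
    deg2_A_ownV_nu4ibk3m1_pp_f_kappa_11 (z 0) (z 1) (z 2) (z 3) (z 4) (z 5) (z 6) (z 7) (z 8),
    deg2_A_ownV_nu4ibk3m1_pp_f_sigma_12 (z 0) (z 1) (z 2) (z 3) (z 4) (z 5) (z 6) (z 7) (z 8),
    deg2_A_ownV_nu4ibk3m1_pp_f_kappa_12 (z 0) (z 1) (z 2) (z 3) (z 4) (z 5) (z 6) (z 7) (z 8),
    deg2_A_ownV_nu4ibk3m1_pp_f_nu_2 (z 0) (z 1) (z 2) (z 3) (z 4) (z 5) (z 6) (z 7) (z 8),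
    deg2_A_ownV_nu4ibk3m1_pp_f_nu_11 (z 0) (z 1) (z 2) (z 3) (z 4) (z 5) (z 6) (z 7) (z 8),
    deg2_A_ownV_nu4ibk3m1_pp_f_nu_12 (z 0) (z 1) (z 2) (z 3) (z 4) (z 5) (z 6) (z 7) (z 8)]

/-- The certificate's `V` on the phase space. [folklore] -/
def deg2_A_ownV_nu4ibk3m1_pp_Vz (z : Fin 9 → ℝ) : ℝ := deg2_A_ownV_nu4ibk3m1_pp_V (z 0) (z 1) (z 2) (z 3) (z 4) (z 5) (z 6) (z 7) (z 8)

/-- Its Lie derivative `∇V·f` (the emitted `Vdot`). [folklore] -/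
def deg2_A_ownV_nu4ibk3m1_pp_LVz (z : Fin 9 → ℝ) : ℝ := deg2_A_ownV_nu4ibk3m1_pp_Vdot (z 0) (z 1) (z 2) (z 3) (z 4) (z 5) (z 6) (z 7) (z 8)

/-- The certified dissipation rate `W = ε_dot·φ`. [folklore] -/
def deg2_A_ownV_nu4ibk3m1_pp_Wz (z : Fin 9 → ℝ) : ℝ := ((1 : ℝ) / 2000) * ((1 : ℝ) * z 0 ^ 2 + (1 : ℝ) * z 1 ^ 2 + (1 : ℝ) * z 2 ^ 2 + (1 : ℝ) * z 3 ^ 2 + (1 : ℝ) * z 4 ^ 2 + (1 : ℝ) * z 5 ^ 2 + ((1 : ℝ) / 4) * z 6 ^ 2 + ((1 : ℝ) / 4) * z 7 ^ 2 + ((1 : ℝ) / 4) * z 8 ^ 2)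

/-- The recast constraint set `M = {h_j = 0}`. [folklore] -/
def deg2_A_ownV_nu4ibk3m1_pp_M : Set (Fin 9 → ℝ) := {z | deg2_A_ownV_nu4ibk3m1_pp_h1 (z 0) (z 1) (z 2) (z 3) (z 4) (z 5) (z 6) (z 7) (z 8) = 0 ∧ deg2_A_ownV_nu4ibk3m1_pp_h2 (z 0) (z 1) (z 2) (z 3) (z 4) (z 5) (z 6) (z 7) (z 8) = 0 ∧ deg2_A_ownV_nu4ibk3m1_pp_h3 (z 0) (z 1) (z 2) (z 3) (z 4) (z 5) (z 6) (z 7) (z 8) = 0}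

/-- The certificate's level `c = 3/53`. [folklore] -/
def deg2_A_ownV_nu4ibk3m1_pp_level : ℝ := ((3 : ℝ) / 53)

/-- Component `0` (`sigma_2`) of the recast field. [folklore] -/
@[simp] theorem deg2_A_ownV_nu4ibk3m1_pp_F_0 (z : Fin 9 → ℝ) : deg2_A_ownV_nu4ibk3m1_pp_F z 0 = deg2_A_ownV_nu4ibk3m1_pp_f_sigma_2 (z 0) (z 1) (z 2) (z 3) (z 4) (z 5) (z 6) (z 7) (z 8) := rfl
/-- Component `1` (`kappa_2`) of the recast field. [folklore] -/
@[simp] theorem deg2_A_ownV_nu4ibk3m1_pp_F_1 (z : Fin 9 → ℝ) : deg2_A_ownV_nu4ibk3m1_pp_F z 1 = deg2_A_ownV_nu4ibk3m1_pp_f_kappa_2 (z 0) (z 1) (z 2) (z 3) (z 4) (z 5) (z 6) (z 7) (z 8) := rfl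
/-- Component `2` (`sigma_11`) of the recast field. [folklore] -/
@[simp] theorem deg2_A_ownV_nu4ibk3m1_pp_F_2 (z : Fin 9 → ℝ) : deg2_A_ownV_nu4ibk3m1_pp_F z 2 = deg2_A_ownV_nu4ibk3m1_pp_f_sigma_11 (z 0) (z 1) (z 2) (z 3) (z 4) (z 5) (z 6) (z 7) (z 8) := rfl
/-- Component `3` (`kappa_11`) of the recast field. [folklore] -/
@[simp] theorem deg2_A_ownV_nu4ibk3m1_pp_F_3 (z : Fin 9 → ℝ) : deg2_A_ownV_nu4ibk3m1_pp_F z 3 = deg2_A_ownV_nu4ibk3m1_pp_f_kappa_11 (z 0) (z 1) (z 2) (z 3) (z 4) (z 5) (z 6) (z 7) (z 8) := rfl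
/-- Component `4` (`sigma_12`) of the recast field. [folklore] -/
@[simp] theorem deg2_A_ownV_nu4ibk3m1_pp_F_4 (z : Fin 9 → ℝ) : deg2_A_ownV_nu4ibk3m1_pp_F z 4 = deg2_A_ownV_nu4ibk3m1_pp_f_sigma_12 (z 0) (z 1) (z 2) (z 3) (z 4) (z 5) (z 6) (z 7) (z 8) := rfl
/-- Component `5` (`kappa_12`) of the recast field. [folklore] -/
@[simp] theorem deg2_A_ownV_nu4ibk3m1_pp_F_5 (z : Fin 9 → ℝ) : deg2_A_ownV_nu4ibk3m1_pp_F z 5 = deg2_A_ownV_nu4ibk3m1_pp_f_kappa_12 (z 0) (z 1) (z 2) (z 3) (z 4) (z 5) (z 6) (z 7) (z 8) := rfl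
/-- Component `6` (`nu_2`) of the recast field. [folklore] -/
@[simp] theorem deg2_A_ownV_nu4ibk3m1_pp_F_6 (z : Fin 9 → ℝ) : deg2_A_ownV_nu4ibk3m1_pp_F z 6 = deg2_A_ownV_nu4ibk3m1_pp_f_nu_2 (z 0) (z 1) (z 2) (z 3) (z 4) (z 5) (z 6) (z 7) (z 8) := rfl
/-- Component `7` (`nu_11`) of the recast field. [folklore] -/
@[simp] theorem deg2_A_ownV_nu4ibk3m1_pp_F_7 (z : Fin 9 → ℝ) : deg2_A_ownV_nu4ibk3m1_pp_F z 7 = deg2_A_ownV_nu4ibk3m1_pp_f_nu_11 (z 0) (z 1) (z 2) (z 3) (z 4) (z 5) (z 6) (z 7) (z 8) := rfl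
/-- Component `8` (`nu_12`) of the recast field. [folklore] -/
@[simp] theorem deg2_A_ownV_nu4ibk3m1_pp_F_8 (z : Fin 9 → ℝ) : deg2_A_ownV_nu4ibk3m1_pp_F z 8 = deg2_A_ownV_nu4ibk3m1_pp_f_nu_12 (z 0) (z 1) (z 2) (z 3) (z 4) (z 5) (z 6) (z 7) (z 8) := rfl

/-! ### Algebraic consequences of the certified identities -/

/-- Dissipation inequality in bridge form on `M ∩ {V ≤ c}`: `LV ≤ −W` (domain hypotheses of the
Bench theorem discharged by `level_in_ball`). CERTIFIED input: `deg2_A_ownV_nu4ibk3m1_pp_Vdot_neg`. [folklore] -/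
theorem deg2_A_ownV_nu4ibk3m1_pp_LVz_le {z : Fin 9 → ℝ} (hz : z ∈ deg2_A_ownV_nu4ibk3m1_pp_M) (hV : deg2_A_ownV_nu4ibk3m1_pp_Vz z ≤ deg2_A_ownV_nu4ibk3m1_pp_level) :
    deg2_A_ownV_nu4ibk3m1_pp_LVz z ≤ -deg2_A_ownV_nu4ibk3m1_pp_Wz z := by
  have h := deg2_A_ownV_nu4ibk3m1_pp_Vdot_neg (z 0) (z 1) (z 2) (z 3) (z 4) (z 5) (z 6) (z 7) (z 8) hV (by have hb := deg2_A_ownV_nu4ibk3m1_pp_level_in_ball (z 0) (z 1) (z 2) (z 3) (z 4) (z 5) (z 6) (z 7) (z 8) hV hz.1 hz.2.1 hz.2.2; linarith) hz.1 hz.2.1 hz.2.2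
  simp only [deg2_A_ownV_nu4ibk3m1_pp_LVz, deg2_A_ownV_nu4ibk3m1_pp_Wz]
  linarith

/-- `W = ε·φ` is positive definite: its only zero is the origin. [folklore] -/
theorem deg2_A_ownV_nu4ibk3m1_pp_eq_zero_of_Wz {z : Fin 9 → ℝ} (hW : deg2_A_ownV_nu4ibk3m1_pp_Wz z = 0) : z = 0 := by
  simp only [deg2_A_ownV_nu4ibk3m1_pp_Wz] at hW
  have e0 : z 0 = 0 := by
    have h : z 0 ^ 2 ≤ 0 := by linarith [sq_nonneg (z 1), sq_nonneg (z 2), sq_nonneg (z 3), sq_nonneg (z 4), sq_nonneg (z 5), sq_nonneg (z 6), sq_nonneg (z 7), sq_nonneg (z 8)]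
    exact (pow_eq_zero_iff two_ne_zero).mp (le_antisymm h (sq_nonneg _))
  have e1 : z 1 = 0 := by
    have h : z 1 ^ 2 ≤ 0 := by linarith [sq_nonneg (z 0), sq_nonneg (z 2), sq_nonneg (z 3), sq_nonneg (z 4), sq_nonneg (z 5), sq_nonneg (z 6), sq_nonneg (z 7), sq_nonneg (z 8)]
    exact (pow_eq_zero_iff two_ne_zero).mp (le_antisymm h (sq_nonneg _))
  have e2 : z 2 = 0 := by
    have h : z 2 ^ 2 ≤ 0 := by linarith [sq_nonneg (z 0), sq_nonneg (z 1), sq_nonneg (z 3), sq_nonneg (z 4), sq_nonneg (z 5), sq_nonneg (z 6), sq_nonneg (z 7), sq_nonneg (z 8)]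
    exact (pow_eq_zero_iff two_ne_zero).mp (le_antisymm h (sq_nonneg _))
  have e3 : z 3 = 0 := by
    have h : z 3 ^ 2 ≤ 0 := by linarith [sq_nonneg (z 0), sq_nonneg (z 1), sq_nonneg (z 2), sq_nonneg (z 4), sq_nonneg (z 5), sq_nonneg (z 6), sq_nonneg (z 7), sq_nonneg (z 8)]
    exact (pow_eq_zero_iff two_ne_zero).mp (le_antisymm h (sq_nonneg _))
  have e4 : z 4 = 0 := by
    have h : z 4 ^ 2 ≤ 0 := by linarith [sq_nonneg (z 0), sq_nonneg (z 1), sq_nonneg (z 2), sq_nonneg (z 3), sq_nonneg (z 5), sq_nonneg (z 6), sq_nonneg (z 7), sq_nonneg (z 8)]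
    exact (pow_eq_zero_iff two_ne_zero).mp (le_antisymm h (sq_nonneg _))
  have e5 : z 5 = 0 := by
    have h : z 5 ^ 2 ≤ 0 := by linarith [sq_nonneg (z 0), sq_nonneg (z 1), sq_nonneg (z 2), sq_nonneg (z 3), sq_nonneg (z 4), sq_nonneg (z 6), sq_nonneg (z 7), sq_nonneg (z 8)]
    exact (pow_eq_zero_iff two_ne_zero).mp (le_antisymm h (sq_nonneg _))
  have e6 : z 6 = 0 := by
    have h : z 6 ^ 2 ≤ 0 := by linarith [sq_nonneg (z 0), sq_nonneg (z 1), sq_nonneg (z 2), sq_nonneg (z 3), sq_nonneg (z 4), sq_nonneg (z 5), sq_nonneg (z 7), sq_nonneg (z 8)]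
    exact (pow_eq_zero_iff two_ne_zero).mp (le_antisymm h (sq_nonneg _))
  have e7 : z 7 = 0 := by
    have h : z 7 ^ 2 ≤ 0 := by linarith [sq_nonneg (z 0), sq_nonneg (z 1), sq_nonneg (z 2), sq_nonneg (z 3), sq_nonneg (z 4), sq_nonneg (z 5), sq_nonneg (z 6), sq_nonneg (z 8)]
    exact (pow_eq_zero_iff two_ne_zero).mp (le_antisymm h (sq_nonneg _))
  have e8 : z 8 = 0 := by
    have h : z 8 ^ 2 ≤ 0 := by linarith [sq_nonneg (z 0), sq_nonneg (z 1), sq_nonneg (z 2), sq_nonneg (z 3), sq_nonneg (z 4), sq_nonneg (z 5), sq_nonneg (z 6), sq_nonneg (z 7)]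
    exact (pow_eq_zero_iff two_ne_zero).mp (le_antisymm h (sq_nonneg _))
  funext i
  fin_cases i <;> simp [e0, e1, e2, e3, e4, e5, e6, e7, e8]

/-- Strictness on every level surface `{V = γ}`, `γ > 0`: `W > 0` there. [folklore] -/
theorem deg2_A_ownV_nu4ibk3m1_pp_Wz_pos {z : Fin 9 → ℝ} {γ : ℝ} (hγ0 : 0 < γ) (hV : deg2_A_ownV_nu4ibk3m1_pp_Vz z = γ) :
    0 < deg2_A_ownV_nu4ibk3m1_pp_Wz z := by
  have hW0 : 0 ≤ deg2_A_ownV_nu4ibk3m1_pp_Wz z := by simp only [deg2_A_ownV_nu4ibk3m1_pp_Wz]; positivity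
  rcases hW0.lt_or_eq with h | h
  · exact h
  · exfalso
    have hz0 := deg2_A_ownV_nu4ibk3m1_pp_eq_zero_of_Wz h.symm
    subst hz0
    simp [deg2_A_ownV_nu4ibk3m1_pp_Vz, deg2_A_ownV_nu4ibk3m1_pp_V_eq] at hV
    linarith

/-- Arc exclusion (A6) on the certified piece: `kappa_2 ≤ 1`. CERTIFIED input: `deg2_A_ownV_nu4ibk3m1_pp_arc_excl_kappa_2`. [folklore] -/
theorem deg2_A_ownV_nu4ibk3m1_pp_arc_kappa_2 {z : Fin 9 → ℝ} (hz : z ∈ deg2_A_ownV_nu4ibk3m1_pp_M) (hV : deg2_A_ownV_nu4ibk3m1_pp_Vz z ≤ deg2_A_ownV_nu4ibk3m1_pp_level) :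
    z 1 ≤ (1 : ℝ) := by
  have h := deg2_A_ownV_nu4ibk3m1_pp_arc_excl_kappa_2 (z 0) (z 1) (z 2) (z 3) (z 4) (z 5) (z 6) (z 7) (z 8) hV hz.1 hz.2.1 hz.2.2
  linarith

/-- Arc exclusion (A6) on the certified piece: `kappa_11 ≤ 1`. CERTIFIED input: `deg2_A_ownV_nu4ibk3m1_pp_arc_excl_kappa_11`. [folklore] -/
theorem deg2_A_ownV_nu4ibk3m1_pp_arc_kappa_11 {z : Fin 9 → ℝ} (hz : z ∈ deg2_A_ownV_nu4ibk3m1_pp_M) (hV : deg2_A_ownV_nu4ibk3m1_pp_Vz z ≤ deg2_A_ownV_nu4ibk3m1_pp_level) :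
    z 3 ≤ (1 : ℝ) := by
  have h := deg2_A_ownV_nu4ibk3m1_pp_arc_excl_kappa_11 (z 0) (z 1) (z 2) (z 3) (z 4) (z 5) (z 6) (z 7) (z 8) hV hz.1 hz.2.1 hz.2.2
  linarith

/-- Arc exclusion (A6) on the certified piece: `kappa_12 ≤ 1`. CERTIFIED input: `deg2_A_ownV_nu4ibk3m1_pp_arc_excl_kappa_12`. [folklore] -/
theorem deg2_A_ownV_nu4ibk3m1_pp_arc_kappa_12 {z : Fin 9 → ℝ} (hz : z ∈ deg2_A_ownV_nu4ibk3m1_pp_M) (hV : deg2_A_ownV_nu4ibk3m1_pp_Vz z ≤ deg2_A_ownV_nu4ibk3m1_pp_level) :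
    z 5 ≤ (1 : ℝ) := by
  have h := deg2_A_ownV_nu4ibk3m1_pp_arc_excl_kappa_12 (z 0) (z 1) (z 2) (z 3) (z 4) (z 5) (z 6) (z 7) (z 8) hV hz.1 hz.2.1 hz.2.2
  linarith

/-- Compactness of the certified piece `S = {z ∈ M | V z ≤ c}` (closed; bounded by
`level_in_ball`: `‖z‖∞ ≤ 2`). [folklore] -/
theorem deg2_A_ownV_nu4ibk3m1_pp_isCompact_S : IsCompact {z ∈ deg2_A_ownV_nu4ibk3m1_pp_M | deg2_A_ownV_nu4ibk3m1_pp_Vz z ≤ deg2_A_ownV_nu4ibk3m1_pp_level} := by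
  have hMc : IsClosed deg2_A_ownV_nu4ibk3m1_pp_M := by
    simp only [deg2_A_ownV_nu4ibk3m1_pp_M, deg2_A_ownV_nu4ibk3m1_pp_h1_eq, deg2_A_ownV_nu4ibk3m1_pp_h2_eq, deg2_A_ownV_nu4ibk3m1_pp_h3_eq]
    exact (isClosed_eq (by fun_prop) continuous_const).inter
      ((isClosed_eq (by fun_prop) continuous_const).inter
      (isClosed_eq (by fun_prop) continuous_const))
  have hVc : Continuous deg2_A_ownV_nu4ibk3m1_pp_Vz := by
    unfold deg2_A_ownV_nu4ibk3m1_pp_Vz; simp only [deg2_A_ownV_nu4ibk3m1_pp_V_eq]; fun_prop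
  have h := isCompact_sublevel_of_norm_le (D := univ) (c := deg2_A_ownV_nu4ibk3m1_pp_level) (R := (2 : ℝ)) hMc
    isClosed_univ hVc.continuousOn ?_
  · rwa [inter_univ] at h
  rintro z ⟨hz, -⟩ hV
  have hball := deg2_A_ownV_nu4ibk3m1_pp_level_in_ball (z 0) (z 1) (z 2) (z 3) (z 4) (z 5) (z 6) (z 7) (z 8) hV hz.1 hz.2.1 hz.2.2
  have hb0 : |z 0| ≤ (2 : ℝ) :=
    abs_le.2 (abs_le_of_sq_le_sq' (by nlinarith [sq_nonneg (z 1), sq_nonneg (z 2), sq_nonneg (z 3), sq_nonneg (z 4), sq_nonneg (z 5), sq_nonneg (z 6), sq_nonneg (z 7), sq_nonneg (z 8)]) (by norm_num))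
  have hb1 : |z 1| ≤ (2 : ℝ) :=
    abs_le.2 (abs_le_of_sq_le_sq' (by nlinarith [sq_nonneg (z 0), sq_nonneg (z 2), sq_nonneg (z 3), sq_nonneg (z 4), sq_nonneg (z 5), sq_nonneg (z 6), sq_nonneg (z 7), sq_nonneg (z 8)]) (by norm_num))
  have hb2 : |z 2| ≤ (2 : ℝ) :=
    abs_le.2 (abs_le_of_sq_le_sq' (by nlinarith [sq_nonneg (z 0), sq_nonneg (z 1), sq_nonneg (z 3), sq_nonneg (z 4), sq_nonneg (z 5), sq_nonneg (z 6), sq_nonneg (z 7), sq_nonneg (z 8)]) (by norm_num))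
  have hb3 : |z 3| ≤ (2 : ℝ) :=
    abs_le.2 (abs_le_of_sq_le_sq' (by nlinarith [sq_nonneg (z 0), sq_nonneg (z 1), sq_nonneg (z 2), sq_nonneg (z 4), sq_nonneg (z 5), sq_nonneg (z 6), sq_nonneg (z 7), sq_nonneg (z 8)]) (by norm_num))
  have hb4 : |z 4| ≤ (2 : ℝ) :=
    abs_le.2 (abs_le_of_sq_le_sq' (by nlinarith [sq_nonneg (z 0), sq_nonneg (z 1), sq_nonneg (z 2), sq_nonneg (z 3), sq_nonneg (z 5), sq_nonneg (z 6), sq_nonneg (z 7), sq_nonneg (z 8)]) (by norm_num))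
  have hb5 : |z 5| ≤ (2 : ℝ) :=
    abs_le.2 (abs_le_of_sq_le_sq' (by nlinarith [sq_nonneg (z 0), sq_nonneg (z 1), sq_nonneg (z 2), sq_nonneg (z 3), sq_nonneg (z 4), sq_nonneg (z 6), sq_nonneg (z 7), sq_nonneg (z 8)]) (by norm_num))
  have hb6 : |z 6| ≤ (2 : ℝ) :=
    abs_le.2 (abs_le_of_sq_le_sq' (by nlinarith [sq_nonneg (z 0), sq_nonneg (z 1), sq_nonneg (z 2), sq_nonneg (z 3), sq_nonneg (z 4), sq_nonneg (z 5), sq_nonneg (z 7), sq_nonneg (z 8)]) (by norm_num))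
  have hb7 : |z 7| ≤ (2 : ℝ) :=
    abs_le.2 (abs_le_of_sq_le_sq' (by nlinarith [sq_nonneg (z 0), sq_nonneg (z 1), sq_nonneg (z 2), sq_nonneg (z 3), sq_nonneg (z 4), sq_nonneg (z 5), sq_nonneg (z 6), sq_nonneg (z 8)]) (by norm_num))
  have hb8 : |z 8| ≤ (2 : ℝ) :=
    abs_le.2 (abs_le_of_sq_le_sq' (by nlinarith [sq_nonneg (z 0), sq_nonneg (z 1), sq_nonneg (z 2), sq_nonneg (z 3), sq_nonneg (z 4), sq_nonneg (z 5), sq_nonneg (z 6), sq_nonneg (z 7)]) (by norm_num))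
  refine (pi_norm_le_iff_of_nonneg (by norm_num)).2 fun i ↦ ?_
  rw [Real.norm_eq_abs]
  fin_cases i
  · simpa using hb0
  · simpa using hb1
  · simpa using hb2
  · simpa using hb3
  · simpa using hb4
  · simpa using hb5
  · simpa using hb6
  · simpa using hb7
  · simpa using hb8

/-! ### Calculus along a solution of the recast system (generic route: `Lyapunov/PolyRecast.lean`) -/

/-- The certificate's `Vdot` polynomial IS the kernel Lie derivative of `V` along `f`
(model-1's `SOS.Poly.lieDeriv`; one `decide`, term order immaterial). [folklore] -/
theorem deg2_A_ownV_nu4ibk3m1_pp_Vdot_isLieDeriv :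
    Poly.isZero (Poly.add deg2_A_ownV_nu4ibk3m1_pp_Vdot_poly (Poly.neg (Poly.lieDeriv [deg2_A_ownV_nu4ibk3m1_pp_f_sigma_2_poly, deg2_A_ownV_nu4ibk3m1_pp_f_kappa_2_poly, deg2_A_ownV_nu4ibk3m1_pp_f_sigma_11_poly, deg2_A_ownV_nu4ibk3m1_pp_f_kappa_11_poly, deg2_A_ownV_nu4ibk3m1_pp_f_sigma_12_poly, deg2_A_ownV_nu4ibk3m1_pp_f_kappa_12_poly, deg2_A_ownV_nu4ibk3m1_pp_f_nu_2_poly, deg2_A_ownV_nu4ibk3m1_pp_f_nu_11_poly, deg2_A_ownV_nu4ibk3m1_pp_f_nu_12_poly] deg2_A_ownV_nu4ibk3m1_pp_V_poly))) = true := by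
  decide +kernel

/-- Coordinatewise form of a solution of the recast system, in the `PolyRecast` vocabulary. [folklore] -/
theorem deg2_A_ownV_nu4ibk3m1_pp_hasDerivWithinAt_coord {z : ℝ → Fin 9 → ℝ} {t : ℝ} {s : Set ℝ}
    (hz : HasDerivWithinAt z (deg2_A_ownV_nu4ibk3m1_pp_F (z t)) s t) (i : Fin 9) :
    HasDerivWithinAt (fun τ ↦ z τ i)
      (Poly.eval (vars (List.ofFn (z t))) ([deg2_A_ownV_nu4ibk3m1_pp_f_sigma_2_poly, deg2_A_ownV_nu4ibk3m1_pp_f_kappa_2_poly, deg2_A_ownV_nu4ibk3m1_pp_f_sigma_11_poly, deg2_A_ownV_nu4ibk3m1_pp_f_kappa_11_poly, deg2_A_ownV_nu4ibk3m1_pp_f_sigma_12_poly, deg2_A_ownV_nu4ibk3m1_pp_f_kappa_12_poly, deg2_A_ownV_nu4ibk3m1_pp_f_nu_2_poly, deg2_A_ownV_nu4ibk3m1_pp_f_nu_11_poly, deg2_A_ownV_nu4ibk3m1_pp_f_nu_12_poly].getD i [])) s t := by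
  have h := (hasDerivWithinAt_pi.1 hz) i
  fin_cases i <;> simpa [deg2_A_ownV_nu4ibk3m1_pp_F, deg2_A_ownV_nu4ibk3m1_pp_f_sigma_2, deg2_A_ownV_nu4ibk3m1_pp_f_kappa_2, deg2_A_ownV_nu4ibk3m1_pp_f_sigma_11, deg2_A_ownV_nu4ibk3m1_pp_f_kappa_11, deg2_A_ownV_nu4ibk3m1_pp_f_sigma_12, deg2_A_ownV_nu4ibk3m1_pp_f_kappa_12, deg2_A_ownV_nu4ibk3m1_pp_f_nu_2, deg2_A_ownV_nu4ibk3m1_pp_f_nu_11, deg2_A_ownV_nu4ibk3m1_pp_f_nu_12] using h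

/-- **Chain rule**: along a curve with right derivative `F (z t)`, `V ∘ z` has derivative
`LV (z t) = Vdot(z t)` (`PolyRecast.hasDerivWithinAt_eval_of_isZero`). [folklore] -/
theorem deg2_A_ownV_nu4ibk3m1_pp_hasDerivWithinAt_Vz {z : ℝ → Fin 9 → ℝ} {t : ℝ} {s : Set ℝ}
    (hz : HasDerivWithinAt z (deg2_A_ownV_nu4ibk3m1_pp_F (z t)) s t) :
    HasDerivWithinAt (deg2_A_ownV_nu4ibk3m1_pp_Vz ∘ z) (deg2_A_ownV_nu4ibk3m1_pp_LVz (z t)) s t := by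
  have h := PolyRecast.hasDerivWithinAt_eval_of_isZero (by decide) deg2_A_ownV_nu4ibk3m1_pp_Vdot_isLieDeriv
    (deg2_A_ownV_nu4ibk3m1_pp_hasDerivWithinAt_coord hz)
  have e1 : deg2_A_ownV_nu4ibk3m1_pp_Vz ∘ z = fun τ ↦ Poly.eval (vars (List.ofFn (z τ))) deg2_A_ownV_nu4ibk3m1_pp_V_poly := by
    funext τ; simp [deg2_A_ownV_nu4ibk3m1_pp_Vz, deg2_A_ownV_nu4ibk3m1_pp_V]
  have e2 : deg2_A_ownV_nu4ibk3m1_pp_LVz (z t) = Poly.eval (vars (List.ofFn (z t))) deg2_A_ownV_nu4ibk3m1_pp_Vdot_poly := by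
    simp [deg2_A_ownV_nu4ibk3m1_pp_LVz, deg2_A_ownV_nu4ibk3m1_pp_Vdot]
  rw [e1, e2]
  exact h

/-- `deg2_A_ownV_nu4ibk3m1_pp_h1` has zero Lie derivative along `f` (one `decide`). [folklore] -/
theorem deg2_A_ownV_nu4ibk3m1_pp_h1_isFirstIntegral : Poly.isZero (Poly.lieDeriv [deg2_A_ownV_nu4ibk3m1_pp_f_sigma_2_poly, deg2_A_ownV_nu4ibk3m1_pp_f_kappa_2_poly, deg2_A_ownV_nu4ibk3m1_pp_f_sigma_11_poly, deg2_A_ownV_nu4ibk3m1_pp_f_kappa_11_poly, deg2_A_ownV_nu4ibk3m1_pp_f_sigma_12_poly, deg2_A_ownV_nu4ibk3m1_pp_f_kappa_12_poly, deg2_A_ownV_nu4ibk3m1_pp_f_nu_2_poly, deg2_A_ownV_nu4ibk3m1_pp_f_nu_11_poly, deg2_A_ownV_nu4ibk3m1_pp_f_nu_12_poly] deg2_A_ownV_nu4ibk3m1_pp_h1_poly) = true := by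
  decide +kernel

/-- **`deg2_A_ownV_nu4ibk3m1_pp_h1` is a first integral** of the recast field: `deg2_A_ownV_nu4ibk3m1_pp_h1 ∘ z` has right derivative `0`.
[folklore] -/
theorem deg2_A_ownV_nu4ibk3m1_pp_hasDerivWithinAt_h1 {z : ℝ → Fin 9 → ℝ} {t : ℝ} {s : Set ℝ}
    (hz : HasDerivWithinAt z (deg2_A_ownV_nu4ibk3m1_pp_F (z t)) s t) :
    HasDerivWithinAt (fun τ ↦ deg2_A_ownV_nu4ibk3m1_pp_h1 (z τ 0) (z τ 1) (z τ 2) (z τ 3) (z τ 4) (z τ 5) (z τ 6) (z τ 7) (z τ 8)) 0 s t := by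
  have h := PolyRecast.hasDerivWithinAt_eval_zero_of_isZero (by decide) deg2_A_ownV_nu4ibk3m1_pp_h1_isFirstIntegral
    (deg2_A_ownV_nu4ibk3m1_pp_hasDerivWithinAt_coord hz)
  have e : (fun τ ↦ deg2_A_ownV_nu4ibk3m1_pp_h1 (z τ 0) (z τ 1) (z τ 2) (z τ 3) (z τ 4) (z τ 5) (z τ 6) (z τ 7) (z τ 8))
      = fun τ ↦ Poly.eval (vars (List.ofFn (z τ))) deg2_A_ownV_nu4ibk3m1_pp_h1_poly := by
    funext τ; simp [deg2_A_ownV_nu4ibk3m1_pp_h1]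
  rw [e]
  exact h

/-- `deg2_A_ownV_nu4ibk3m1_pp_h2` has zero Lie derivative along `f` (one `decide`). [folklore] -/
theorem deg2_A_ownV_nu4ibk3m1_pp_h2_isFirstIntegral : Poly.isZero (Poly.lieDeriv [deg2_A_ownV_nu4ibk3m1_pp_f_sigma_2_poly, deg2_A_ownV_nu4ibk3m1_pp_f_kappa_2_poly, deg2_A_ownV_nu4ibk3m1_pp_f_sigma_11_poly, deg2_A_ownV_nu4ibk3m1_pp_f_kappa_11_poly, deg2_A_ownV_nu4ibk3m1_pp_f_sigma_12_poly, deg2_A_ownV_nu4ibk3m1_pp_f_kappa_12_poly, deg2_A_ownV_nu4ibk3m1_pp_f_nu_2_poly, deg2_A_ownV_nu4ibk3m1_pp_f_nu_11_poly, deg2_A_ownV_nu4ibk3m1_pp_f_nu_12_poly] deg2_A_ownV_nu4ibk3m1_pp_h2_poly) = true := by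
  decide +kernel

/-- **`deg2_A_ownV_nu4ibk3m1_pp_h2` is a first integral** of the recast field: `deg2_A_ownV_nu4ibk3m1_pp_h2 ∘ z` has right derivative `0`.
[folklore] -/
theorem deg2_A_ownV_nu4ibk3m1_pp_hasDerivWithinAt_h2 {z : ℝ → Fin 9 → ℝ} {t : ℝ} {s : Set ℝ}
    (hz : HasDerivWithinAt z (deg2_A_ownV_nu4ibk3m1_pp_F (z t)) s t) :
    HasDerivWithinAt (fun τ ↦ deg2_A_ownV_nu4ibk3m1_pp_h2 (z τ 0) (z τ 1) (z τ 2) (z τ 3) (z τ 4) (z τ 5) (z τ 6) (z τ 7) (z τ 8)) 0 s t := by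
  have h := PolyRecast.hasDerivWithinAt_eval_zero_of_isZero (by decide) deg2_A_ownV_nu4ibk3m1_pp_h2_isFirstIntegral
    (deg2_A_ownV_nu4ibk3m1_pp_hasDerivWithinAt_coord hz)
  have e : (fun τ ↦ deg2_A_ownV_nu4ibk3m1_pp_h2 (z τ 0) (z τ 1) (z τ 2) (z τ 3) (z τ 4) (z τ 5) (z τ 6) (z τ 7) (z τ 8))
      = fun τ ↦ Poly.eval (vars (List.ofFn (z τ))) deg2_A_ownV_nu4ibk3m1_pp_h2_poly := by
    funext τ; simp [deg2_A_ownV_nu4ibk3m1_pp_h2]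
  rw [e]
  exact h

/-- `deg2_A_ownV_nu4ibk3m1_pp_h3` has zero Lie derivative along `f` (one `decide`). [folklore] -/
theorem deg2_A_ownV_nu4ibk3m1_pp_h3_isFirstIntegral : Poly.isZero (Poly.lieDeriv [deg2_A_ownV_nu4ibk3m1_pp_f_sigma_2_poly, deg2_A_ownV_nu4ibk3m1_pp_f_kappa_2_poly, deg2_A_ownV_nu4ibk3m1_pp_f_sigma_11_poly, deg2_A_ownV_nu4ibk3m1_pp_f_kappa_11_poly, deg2_A_ownV_nu4ibk3m1_pp_f_sigma_12_poly, deg2_A_ownV_nu4ibk3m1_pp_f_kappa_12_poly, deg2_A_ownV_nu4ibk3m1_pp_f_nu_2_poly, deg2_A_ownV_nu4ibk3m1_pp_f_nu_11_poly, deg2_A_ownV_nu4ibk3m1_pp_f_nu_12_poly] deg2_A_ownV_nu4ibk3m1_pp_h3_poly) = true := by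
  decide +kernel

/-- **`deg2_A_ownV_nu4ibk3m1_pp_h3` is a first integral** of the recast field: `deg2_A_ownV_nu4ibk3m1_pp_h3 ∘ z` has right derivative `0`.
[folklore] -/
theorem deg2_A_ownV_nu4ibk3m1_pp_hasDerivWithinAt_h3 {z : ℝ → Fin 9 → ℝ} {t : ℝ} {s : Set ℝ}
    (hz : HasDerivWithinAt z (deg2_A_ownV_nu4ibk3m1_pp_F (z t)) s t) :
    HasDerivWithinAt (fun τ ↦ deg2_A_ownV_nu4ibk3m1_pp_h3 (z τ 0) (z τ 1) (z τ 2) (z τ 3) (z τ 4) (z τ 5) (z τ 6) (z τ 7) (z τ 8)) 0 s t := by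
  have h := PolyRecast.hasDerivWithinAt_eval_zero_of_isZero (by decide) deg2_A_ownV_nu4ibk3m1_pp_h3_isFirstIntegral
    (deg2_A_ownV_nu4ibk3m1_pp_hasDerivWithinAt_coord hz)
  have e : (fun τ ↦ deg2_A_ownV_nu4ibk3m1_pp_h3 (z τ 0) (z τ 1) (z τ 2) (z τ 3) (z τ 4) (z τ 5) (z τ 6) (z τ 7) (z τ 8))
      = fun τ ↦ Poly.eval (vars (List.ofFn (z τ))) deg2_A_ownV_nu4ibk3m1_pp_h3_poly := by
    funext τ; simp [deg2_A_ownV_nu4ibk3m1_pp_h3]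
  rw [e]
  exact h

/-- A solution of the recast system starting on `M` stays on `M` (the constraints are first
integrals). [folklore] -/
theorem deg2_A_ownV_nu4ibk3m1_pp_mem_M {z : ℝ → Fin 9 → ℝ} (hzc : ContinuousOn z (Ici 0))
    (hz : ∀ t, 0 ≤ t → HasDerivWithinAt z (deg2_A_ownV_nu4ibk3m1_pp_F (z t)) (Ici t) t)
    (h0 : z 0 ∈ deg2_A_ownV_nu4ibk3m1_pp_M) : ∀ t, 0 ≤ t → z t ∈ deg2_A_ownV_nu4ibk3m1_pp_M := by
  intro T hT
  have hc0 : ContinuousOn (fun τ ↦ deg2_A_ownV_nu4ibk3m1_pp_h1 (z τ 0) (z τ 1) (z τ 2) (z τ 3) (z τ 4) (z τ 5) (z τ 6) (z τ 7) (z τ 8)) (Icc 0 T) := by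
    have hc : Continuous fun y : Fin 9 → ℝ ↦ deg2_A_ownV_nu4ibk3m1_pp_h1 (y 0) (y 1) (y 2) (y 3) (y 4) (y 5) (y 6) (y 7) (y 8) := by
      simp only [deg2_A_ownV_nu4ibk3m1_pp_h1_eq]; fun_prop
    exact hc.comp_continuousOn (hzc.mono fun s hs ↦ hs.1)
  have k0 := constant_of_has_deriv_right_zero hc0
    (fun t ht ↦ deg2_A_ownV_nu4ibk3m1_pp_hasDerivWithinAt_h1 (hz t ht.1)) T ⟨hT, le_rfl⟩
  have z0 : deg2_A_ownV_nu4ibk3m1_pp_h1 (z 0 0) (z 0 1) (z 0 2) (z 0 3) (z 0 4) (z 0 5) (z 0 6) (z 0 7) (z 0 8) = 0 := h0.1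
  have hc1 : ContinuousOn (fun τ ↦ deg2_A_ownV_nu4ibk3m1_pp_h2 (z τ 0) (z τ 1) (z τ 2) (z τ 3) (z τ 4) (z τ 5) (z τ 6) (z τ 7) (z τ 8)) (Icc 0 T) := by
    have hc : Continuous fun y : Fin 9 → ℝ ↦ deg2_A_ownV_nu4ibk3m1_pp_h2 (y 0) (y 1) (y 2) (y 3) (y 4) (y 5) (y 6) (y 7) (y 8) := by
      simp only [deg2_A_ownV_nu4ibk3m1_pp_h2_eq]; fun_prop
    exact hc.comp_continuousOn (hzc.mono fun s hs ↦ hs.1)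
  have k1 := constant_of_has_deriv_right_zero hc1
    (fun t ht ↦ deg2_A_ownV_nu4ibk3m1_pp_hasDerivWithinAt_h2 (hz t ht.1)) T ⟨hT, le_rfl⟩
  have z1 : deg2_A_ownV_nu4ibk3m1_pp_h2 (z 0 0) (z 0 1) (z 0 2) (z 0 3) (z 0 4) (z 0 5) (z 0 6) (z 0 7) (z 0 8) = 0 := h0.2.1
  have hc2 : ContinuousOn (fun τ ↦ deg2_A_ownV_nu4ibk3m1_pp_h3 (z τ 0) (z τ 1) (z τ 2) (z τ 3) (z τ 4) (z τ 5) (z τ 6) (z τ 7) (z τ 8)) (Icc 0 T) := by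
    have hc : Continuous fun y : Fin 9 → ℝ ↦ deg2_A_ownV_nu4ibk3m1_pp_h3 (y 0) (y 1) (y 2) (y 3) (y 4) (y 5) (y 6) (y 7) (y 8) := by
      simp only [deg2_A_ownV_nu4ibk3m1_pp_h3_eq]; fun_prop
    exact hc.comp_continuousOn (hzc.mono fun s hs ↦ hs.1)
  have k2 := constant_of_has_deriv_right_zero hc2
    (fun t ht ↦ deg2_A_ownV_nu4ibk3m1_pp_hasDerivWithinAt_h3 (hz t ht.1)) T ⟨hT, le_rfl⟩
  have z2 : deg2_A_ownV_nu4ibk3m1_pp_h3 (z 0 0) (z 0 1) (z 0 2) (z 0 3) (z 0 4) (z 0 5) (z 0 6) (z 0 7) (z 0 8) = 0 := h0.2.2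
  exact ⟨by show deg2_A_ownV_nu4ibk3m1_pp_h1 (z T 0) (z T 1) (z T 2) (z T 3) (z T 4) (z T 5) (z T 6) (z T 7) (z T 8) = 0; rw [k0, z0], by show deg2_A_ownV_nu4ibk3m1_pp_h2 (z T 0) (z T 1) (z T 2) (z T 3) (z T 4) (z T 5) (z T 6) (z T 7) (z T 8) = 0; rw [k1, z1], by show deg2_A_ownV_nu4ibk3m1_pp_h3 (z T 0) (z T 1) (z T 2) (z T 3) (z T 4) (z T 5) (z T 6) (z T 7) (z T 8) = 0; rw [k2, z2]⟩

/-! ### The ROA inclusion for the recast model -/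

/-- **G1-roa (recast coordinates).** MODELLED: the recast polynomial system `ż = F(z)` on
`{h = 0}` of the instance (model-1's `polyField`, interface I2; MODEL-VALIDITY row of the Bench
file). CERTIFIED inputs: the kernel-checked identities of the Bench file. STATEMENT: for every level
`0 < γ ≤ c = 3/53` and every solution `z` on `[0, ∞)` (Mathlib sense: continuous, right derivative
`F (z t)`) with `z 0 ∈ M`, `V(z 0) ≤ γ`: `V(z t) ≤ γ` and the arc bounds for all `t ≥ 0`, and `z t → 0`.
Via `Lyapunov.certificate_invariance_tendsto_univ`. No sentence here says a machine or a grid is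
stable. [folklore] -/
theorem deg2_A_ownV_nu4ibk3m1_pp_roa {γ : ℝ} (hγ0 : 0 < γ) (hγ : γ ≤ deg2_A_ownV_nu4ibk3m1_pp_level) {z : ℝ → Fin 9 → ℝ}
    (hzc : ContinuousOn z (Ici 0))
    (hz : ∀ t, 0 ≤ t → HasDerivWithinAt z (deg2_A_ownV_nu4ibk3m1_pp_F (z t)) (Ici t) t)
    (h0M : z 0 ∈ deg2_A_ownV_nu4ibk3m1_pp_M) (h0V : deg2_A_ownV_nu4ibk3m1_pp_Vz (z 0) ≤ γ) :
    (∀ t, 0 ≤ t → deg2_A_ownV_nu4ibk3m1_pp_Vz (z t) ≤ γ ∧ z t 1 ≤ (1 : ℝ) ∧ z t 3 ≤ (1 : ℝ) ∧ z t 5 ≤ (1 : ℝ)) ∧ Tendsto z atTop (𝓝 0) := by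
  have hF : Continuous deg2_A_ownV_nu4ibk3m1_pp_F := by
    refine continuous_pi fun i ↦ ?_
    fin_cases i <;> simp [deg2_A_ownV_nu4ibk3m1_pp_F, deg2_A_ownV_nu4ibk3m1_pp_f_sigma_2_eq, deg2_A_ownV_nu4ibk3m1_pp_f_kappa_2_eq, deg2_A_ownV_nu4ibk3m1_pp_f_sigma_11_eq, deg2_A_ownV_nu4ibk3m1_pp_f_kappa_11_eq, deg2_A_ownV_nu4ibk3m1_pp_f_sigma_12_eq, deg2_A_ownV_nu4ibk3m1_pp_f_kappa_12_eq, deg2_A_ownV_nu4ibk3m1_pp_f_nu_2_eq, deg2_A_ownV_nu4ibk3m1_pp_f_nu_11_eq, deg2_A_ownV_nu4ibk3m1_pp_f_nu_12_eq] <;> fun_prop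
  have hV : Continuous deg2_A_ownV_nu4ibk3m1_pp_Vz := by unfold deg2_A_ownV_nu4ibk3m1_pp_Vz; simp only [deg2_A_ownV_nu4ibk3m1_pp_V_eq]; fun_prop
  have hW : Continuous deg2_A_ownV_nu4ibk3m1_pp_Wz := by unfold deg2_A_ownV_nu4ibk3m1_pp_Wz; fun_prop
  have h0 : (0 : Fin 9 → ℝ) ∈ deg2_A_ownV_nu4ibk3m1_pp_M := by simp [deg2_A_ownV_nu4ibk3m1_pp_M, deg2_A_ownV_nu4ibk3m1_pp_h1_eq, deg2_A_ownV_nu4ibk3m1_pp_h2_eq, deg2_A_ownV_nu4ibk3m1_pp_h3_eq]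
  have hMc : IsClosed deg2_A_ownV_nu4ibk3m1_pp_M := by
    simp only [deg2_A_ownV_nu4ibk3m1_pp_M, deg2_A_ownV_nu4ibk3m1_pp_h1_eq, deg2_A_ownV_nu4ibk3m1_pp_h2_eq, deg2_A_ownV_nu4ibk3m1_pp_h3_eq]
    exact (isClosed_eq (by fun_prop) continuous_const).inter
      ((isClosed_eq (by fun_prop) continuous_const).inter
      (isClosed_eq (by fun_prop) continuous_const))
  have hSγ : IsCompact {y ∈ deg2_A_ownV_nu4ibk3m1_pp_M | deg2_A_ownV_nu4ibk3m1_pp_Vz y ≤ γ} :=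
    deg2_A_ownV_nu4ibk3m1_pp_isCompact_S.of_isClosed_subset (hMc.inter (isClosed_le hV continuous_const))
      (fun y hy ↦ ⟨hy.1, hy.2.trans hγ⟩)
  have h := certificate_invariance_tendsto_univ (M := deg2_A_ownV_nu4ibk3m1_pp_M) (LV := deg2_A_ownV_nu4ibk3m1_pp_LVz) (W := deg2_A_ownV_nu4ibk3m1_pp_Wz)
    (x₀ := 0) hSγ hF.continuousOn hV.continuousOn hW.continuousOn
    (fun y hy hVy ↦ deg2_A_ownV_nu4ibk3m1_pp_LVz_le hy (hVy.trans hγ))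
    (fun y _ _ ↦ by simp only [deg2_A_ownV_nu4ibk3m1_pp_Wz]; positivity)
    (fun y _ hVy ↦ deg2_A_ownV_nu4ibk3m1_pp_Wz_pos hγ0 hVy)
    h0 (by simp [deg2_A_ownV_nu4ibk3m1_pp_Vz, deg2_A_ownV_nu4ibk3m1_pp_V_eq]; exact hγ0.le) (by simp [deg2_A_ownV_nu4ibk3m1_pp_Wz])
    (fun y _ _ hWy ↦ deg2_A_ownV_nu4ibk3m1_pp_eq_zero_of_Wz hWy)
    hzc hz (fun t ht ↦ deg2_A_ownV_nu4ibk3m1_pp_hasDerivWithinAt_Vz (hz t ht)) (deg2_A_ownV_nu4ibk3m1_pp_mem_M hzc hz h0M) h0V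
  have hM := deg2_A_ownV_nu4ibk3m1_pp_mem_M hzc hz h0M
  exact ⟨fun t ht ↦ ⟨h.1 t ht, deg2_A_ownV_nu4ibk3m1_pp_arc_kappa_2 (hM t ht) ((h.1 t ht).trans hγ), deg2_A_ownV_nu4ibk3m1_pp_arc_kappa_11 (hM t ht) ((h.1 t ht).trans hγ), deg2_A_ownV_nu4ibk3m1_pp_arc_kappa_12 (hM t ht) ((h.1 t ht).trans hγ)⟩, h.2⟩

end

end Summit.Ventures.GridStability.Bench.KUNDUR2ACSG
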